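import Literature.MathematicalPhysics.QuantumLattice.HubbardHalfFilledGroundStateRectTorus
import Literature.MathematicalPhysics.QuantumLattice.HubbardBootstrapCertificateResidual
import Summits.HubbardSuperconductivity.HubbardLadder.HubbardSingletRows
import HarnessLib

/-!
# Certificate rows with Lieb's spin-reflection Gram blocks on even RECTANGULAR tori (`liebgram`)

HONEST FRAMING: ladder R1–R4 with certified numbers; no claim on H/H₀. Family `hubbard`, cell
`pub-hubbard` (solver-side row menu for the certificate pipeline at half filling, `n = 1`); the
rectangular-torus companion of `LiebGramRows.lean` (square tori `hubbardTorus 2 L`), covering the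
`a × b` development cells of the engines (e.g. `4 × 2`: `hamiltonian (fermionRectTorusGraph 4 2) t U`
at `N = 8`).

The Literature file `HubbardHalfFilledGroundStateRectTorus` proves Lieb's hypotheses on the
rectangular fermionic torus `ℤ/aℤ × ℤ/bℤ` with `a, b` even and nonzero (connected; the colour
classes of `rectStagger (x, y) = (-1)^{x+y}` equinumerous), hence Lieb's Theorem 2 there (THE
half-filled ground state: unique, a singlet, in `S^z = 0`) and the positive-semidefiniteness of the
Gram blocks `[⟨ψ, u(w i) d̃(w j) ψ⟩]_{ij}`, `[⟨ψ, d(w i) ũ(w j) ψ⟩]_{ij}` of THE half-filled ground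
state (`hubbardRectTorus_liebGram_posSemidef(_flip)`, Shiba sign `rectSign a b`), i.e. the
nonnegativity of the Lieb forms `LiebTwo.liebForm (rectSign a b) G w`,
`LiebTwo.liebFormFlip (rectSign a b) G' w'` for `G, G' ⪰ 0` (Lieb, PRL 62 (1989) 1201, proof of
Theorem 2; Kull–Schuch–Dive–Navascués, PRX 14 (2024) 021008 §5.3).

This file states the resulting ROWS exactly in the shape of `LiebGramRows` / `HubbardSingletRows`
(menu `singletSectorAnn (ab) = ![N̂ − ab, S^z, S⁺, (S⁺)ᴴ]` of annihilators of the singlet ground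
state; the two Lieb forms; a residual `R` with `R + δ·1 ⪰ 0` or a monomial residual `Σ_k a_k M_k`,
`δ = Σ_k ‖a_k‖`, `Matrix.posSemidef_sum_smul_add_of_isContraction`):

* `rect_halfFilled_sectorGS_eigen` — an `(ab, S^z = 0)` sector ground state is an `ab`-particle
  eigenvector at `E₀(ab) = groundEnergyAt (fermionRectTorusGraph a b) t U (ab)`
  (`groundEnergyAt_eq_minEnergyOn_szSector`);
* `rect_groundEnergyAt_halfFilling_ge_of_certificate_liebGram` (R1): `H − c·1 = SOS + null +
  (liebForm + liebFormFlip + R)` ⟹ `c − δ ≤ E₀(ab)`; `…_liebGram_residual`: monomial residual,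
  `c − Σ‖a_k‖ ≤ E₀(ab)`;
* `rect_re_expect_halfFilledGS_ge_of_windowCertificate_liebGram` (R2): `V − c·1 = SOS + null +
  μ (E_up − H) + ν (H − E_lo) + (liebForm + liebFormFlip + R)`, `μ, ν ≥ 0`,
  `E_lo ≤ E₀(ab) ≤ E_up` ⟹ `c − δ ≤ Re ⟨ψ, V ψ⟩` for every normalised `(ab, S^z = 0)` sector
  ground state `ψ`; `…_le_…`: the upper-bound form.

NOTE for certificate files at the concrete torus: elaborate the identity with the order-derived
`DecidableEq (Fin a ×ₗ Fin b)` (`LinearOrder.toDecidableEq`, the local instance of this file), the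
instance all orbital-generic lemmas carry.

References: [cite: LiebPRL1989, proof of Theorem 2]; [cite: KullEtAl2024, §5.3];
[cite: Han2020Bootstrap, §2 eq. (3)]; [cite: WangEtAl2024, §3 eq. (4)].
-/

noncomputable section

namespace Summit.HubbardSuperconductivity.HubbardLadder

open Matrix Finset Literature.MathematicalPhysics.QuantumLattice
  Literature.MathematicalPhysics.QuantumLattice.LiebTwo
  Literature.MathematicalPhysics.QuantumManyBody.StateRelaxation
open scoped ComplexOrder MatrixOrder

/-- The vector state of `StateRelaxationDuality` under an unambiguous local name (the opened
namespace `QuantumLattice` has a `vectorState` of its own, `CorrelationLightCone`). -/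
local notation "srState" => Literature.MathematicalPhysics.QuantumManyBody.StateRelaxation.vectorState

/-- Unfolding `srState`. [folklore] -/
private theorem srState_apply {n : Type*} [Fintype n] (v : n → ℂ) (O : Matrix n n ℂ) :
    srState v O = star v ⬝ᵥ O *ᵥ v := rfl

/-- `-δ ≤ Re ⟨v, R v⟩` for `R + δ·1 ⪰ 0` and a unit vector `v`. [folklore] -/
private theorem re_srState_ge_of_posSemidef_add {n : Type*} [Fintype n] [DecidableEq n]
    {v : n → ℂ} (hv : star v ⬝ᵥ v = 1) {R : Matrix n n ℂ} {δ : ℝ}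
    (hR : (R + (δ : ℂ) • (1 : Matrix n n ℂ)).PosSemidef) : -δ ≤ (srState v R).re := by
  have h := hR.dotProduct_mulVec_nonneg v
  rw [add_mulVec, dotProduct_add, Matrix.smul_mulVec, one_mulVec, dotProduct_smul, hv,
    smul_eq_mul, mul_one] at h
  obtain ⟨hre, -⟩ := Complex.nonneg_iff.mp h
  rw [Complex.add_re, Complex.ofReal_re] at hre
  rw [srState_apply]; linarith

section RectTorus

variable (a b : ℕ) [NeZero a] [NeZero b]

/-- (Local to this file, as in `HubbardTorusLocalCertificate` / `LiebGramRows`.) Equality of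
rectangular-torus sites is decided through the LINEAR ORDER — the instance every orbital-generic lemma of the tree
(`isContraction_prod_ladder`, the Jordan–Wigner matrices, …) carries once specialised to
`Λ = Fin a ×ₗ Fin b`; the structural `Lex/Pi/Fin` instance found at the concrete type is only
propositionally equal to it. No library instance is overridden outside this file. [folklore] -/
local instance (priority := high) instDecidableEqRectTorusLiebRows :
    DecidableEq (Fin a ×ₗ Fin b) :=
  LinearOrder.toDecidableEq

variable {m : Type*} [Fintype m] [DecidableEq m]

omit [NeZero a] [NeZero b] in
/-- An `(ab, S^z = 0)` sector ground state of the rectangular Hubbard torus is an `ab`-particle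
vector with `H ψ = E₀(ab) ψ` (`E₀(ab) = groundEnergyAt`, the `ab`-sector ground energy: every
even-`N` sector level is attained at `S^z = 0`, `groundEnergyAt_eq_minEnergyOn_szSector`).
[cite: LiebPRL1989, proof of Theorem 1] -/
theorem rect_halfFilled_sectorGS_eigen (ha : Even a) (t U : ℝ) {ψ : Fock (Orb (Fin a ×ₗ Fin b))}
    (hψ : IsGroundStateInSector (hamiltonian (fermionRectTorusGraph a b) t U) (a * b) 0 ψ) :
    IsNParticle (a * b) ψ ∧ hamiltonian (fermionRectTorusGraph a b) t U *ᵥ ψ =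
      ((groundEnergyAt (fermionRectTorusGraph a b) t U (a * b) : ℝ) : ℂ) • ψ := by
  refine ⟨((mem_szSector_iff _ _ _).1 hψ.1).1, ?_⟩
  have hE2 : Even (a * b) := ha.mul_right b
  have hn : a * b / 2 ≤ Fintype.card (Fin a ×ₗ Fin b) := by
    rw [card_rectSites]
    exact Nat.div_le_self _ _
  have h := groundEnergyAt_eq_minEnergyOn_szSector (fermionRectTorusGraph a b) t U hn
  rw [Nat.two_mul_div_two_of_even hE2] at h
  rw [hψ.2.2, h]

omit [NeZero a] [NeZero b] in
/-- The null part of a row evaluated in a half-filled singlet vector vanishes: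
commutators with `H` in an eigenvector, menu ideal terms. [folklore] -/
private theorem rect_srState_null_eq_zero {t U : ℝ} {ψ : Fock (Orb (Fin a ×ₗ Fin b))}
    (hN : IsNParticle (a * b) ψ) (hS : spinSq *ᵥ ψ = 0)
    (hHψ : hamiltonian (fermionRectTorusGraph a b) t U *ᵥ ψ =
      ((groundEnergyAt (fermionRectTorusGraph a b) t U (a * b) : ℝ) : ℂ) • ψ)
    {κ : Type*} (s : Finset κ)
    (X : κ → Matrix (Finset (Orb (Fin a ×ₗ Fin b))) (Finset (Orb (Fin a ×ₗ Fin b))) ℂ)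
    {ι : Type*} (t' : Finset ι)
    (Y Y' : ι → Matrix (Finset (Orb (Fin a ×ₗ Fin b))) (Finset (Orb (Fin a ×ₗ Fin b))) ℂ)
    (e e' : ι → Fin 4) :
    srState ψ (∑ k ∈ s, (hamiltonian (fermionRectTorusGraph a b) t U * X k - X k * hamiltonian (fermionRectTorusGraph a b) t U) +
        ∑ q ∈ t', (Y q * singletSectorAnn (a * b) (e q) + singletSectorAnn (a * b) (e' q) * Y' q)) =
      0 := by
  have hHerm : (hamiltonian (fermionRectTorusGraph a b) t U).IsHermitian :=
    LiebThm1.hamiltonian_isHermitian (fermionRectTorusGraph a b) t U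
  have h1 : ∀ k ∈ s, srState ψ (hamiltonian (fermionRectTorusGraph a b) t U * X k - X k * hamiltonian (fermionRectTorusGraph a b) t U) = 0 :=
    fun k _ => vectorState_commutator hHerm hHψ (X k)
  have h2 : ∀ q ∈ t',
      srState ψ (Y q * singletSectorAnn (a * b) (e q) + singletSectorAnn (a * b) (e' q) * Y' q) =
        0 := fun q _ => by
    rw [map_add, vectorState_mul_of_mulVec_eq_zero ψ (Y q)
        (singletSectorAnn_mulVec_eq_zero (a * b) hN hS (e q)),
      vectorState_mul_of_conjTranspose_mulVec_eq_zero ψ (Y' q)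
        (conjTranspose_singletSectorAnn_mulVec_eq_zero (a * b) hN hS (e' q)), add_zero]
  rw [map_add, map_sum, map_sum, Finset.sum_eq_zero h1, Finset.sum_eq_zero h2, add_zero]

/-- **Energy row with Lieb Gram blocks and a residual on the even rectangular torus (R1 rows at
`n = 1`).** For `a, b` even and nonzero,
`t ≠ 0`, `U > 0`: an identity
`H − c·1 = Σ Λᵢⱼ Oᵢᴴ Oⱼ + (Σ_k (H X_k − X_k H) + Σ_q (Y_q Z_{e q} + Z_{e' q} Y'_q))
  + (liebForm ε G w + liebFormFlip ε G' w' + R)`, `Λ, G, G' ⪰ 0`, `Z` from the menu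
`singletSectorAnn (ab)`, `R + δ·1 ⪰ 0`, proves
`c − δ ≤ E₀(ab) = groundEnergyAt (fermionRectTorusGraph a b) t U (ab)` — evaluate in THE half-filled
ground state, a singlet with Lieb's positive definite coefficient matrix. [cite: LiebPRL1989, proof of Theorem 2] [cite: KullEtAl2024, §5.3] -/
theorem rect_groundEnergyAt_halfFilling_ge_of_certificate_liebGram (ha : Even a) (hb : Even b) {t U : ℝ} (ht : t ≠ 0)
    (hU : 0 < U) {Λm : Matrix m m ℂ} (hΛ : Λm.PosSemidef)
    (O : m → Matrix (Finset (Orb (Fin a ×ₗ Fin b))) (Finset (Orb (Fin a ×ₗ Fin b))) ℂ)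
    {κ : Type*} (s : Finset κ)
    (X : κ → Matrix (Finset (Orb (Fin a ×ₗ Fin b))) (Finset (Orb (Fin a ×ₗ Fin b))) ℂ)
    {ι : Type*} (t' : Finset ι)
    (Y Y' : ι → Matrix (Finset (Orb (Fin a ×ₗ Fin b))) (Finset (Orb (Fin a ×ₗ Fin b))) ℂ)
    (e e' : ι → Fin 4)
    {κ₁ : Type*} [Fintype κ₁] {Gm : Matrix κ₁ κ₁ ℂ} (hGm : Gm.PosSemidef)
    (w : κ₁ → List ((Fin a ×ₗ Fin b) × (Fin a ×ₗ Fin b)))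
    {κ₂ : Type*} [Fintype κ₂] {Gm' : Matrix κ₂ κ₂ ℂ} (hGm' : Gm'.PosSemidef)
    (w' : κ₂ → List ((Fin a ×ₗ Fin b) × (Fin a ×ₗ Fin b)))
    {R : Matrix (Finset (Orb (Fin a ×ₗ Fin b))) (Finset (Orb (Fin a ×ₗ Fin b))) ℂ} {δ : ℝ}
    (hR : (R + (δ : ℂ) • (1 : Matrix (Finset (Orb (Fin a ×ₗ Fin b))) _ ℂ)).PosSemidef) {c : ℝ}
    (hcert : hamiltonian (fermionRectTorusGraph a b) t U - (c : ℂ) • 1 =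
      gramForm Λm O + (∑ k ∈ s, (hamiltonian (fermionRectTorusGraph a b) t U * X k - X k * hamiltonian (fermionRectTorusGraph a b) t U) +
        ∑ q ∈ t', (Y q * singletSectorAnn (a * b) (e q) + singletSectorAnn (a * b) (e' q) * Y' q)) +
        (liebForm (rectSign a b) Gm w + liebFormFlip (rectSign a b) Gm' w' + R)) :
    c - δ ≤ groundEnergyAt (fermionRectTorusGraph a b) t U (a * b) := by
  classical
  obtain ⟨ψ, hψK, h1, hHψ, hS, -⟩ :=
    LiebHalfFilled.hubbardRectTorus_exists_unit_groundState (a := a) (b := b) ha hb ht hU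
  have hN : IsNParticle (a * b) ψ := ((mem_szSector_iff _ _ _).1 hψK).1
  have hHψ' : hamiltonian (fermionRectTorusGraph a b) t U *ᵥ ψ =
      ((groundEnergyAt (fermionRectTorusGraph a b) t U (a * b) : ℝ) : ℂ) • ψ := hHψ
  have hpos : ∀ x, 0 ≤ srState ψ (star x * x) := fun x => vectorState_nonneg ψ x
  have hone : srState ψ 1 = 1 := by rw [srState_apply, one_mulVec, h1]
  have hn := rect_srState_null_eq_zero a b hN hS hHψ' s X t' Y Y' e e'
  have hP : 0 ≤ (srState ψ (liebForm (rectSign a b) Gm w)).re := by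
    rw [srState_apply]
    exact (Complex.nonneg_iff.mp (hubbardRectTorus_liebForm_expect_nonneg ha hb ht hU hN hHψ' hGm w)).1
  have hP' : 0 ≤ (srState ψ (liebFormFlip (rectSign a b) Gm' w')).re := by
    rw [srState_apply]
    exact (Complex.nonneg_iff.mp
      (hubbardRectTorus_liebFormFlip_expect_nonneg ha hb ht hU hN hHψ' hGm' w')).1
  have hRre := re_srState_ge_of_posSemidef_add h1 hR
  have hr : -δ ≤ (srState ψ (liebForm (rectSign a b) Gm w + liebFormFlip (rectSign a b) Gm' w' + R)).re := by
    simp only [map_add, Complex.add_re]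
    linarith
  have h := le_re_map_of_certificate_residual (srState ψ) hpos hone hΛ O hn hr hcert
  rwa [srState_apply, hHψ', dotProduct_smul, h1, smul_eq_mul, mul_one, Complex.ofReal_re] at h

/-- **Energy row with Lieb Gram blocks and a monomial residual** (the form a rounded certificate
has): as `groundEnergyAt_halfFilling_ge_of_certificate_liebGram` with residual `Σ_k a_k M_k`,
`M_k` fermionic monomials (products of creation/annihilation matrices), `Σ_k a_k M_k` Hermitian;
proves `c − Σ_k ‖a_k‖ ≤ E₀(ab)`. [cite: LiebPRL1989, proof of Theorem 2]
[cite: Han2020Bootstrap, §2 eq. (3)] -/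
theorem rect_groundEnergyAt_halfFilling_ge_of_certificate_liebGram_residual (ha : Even a) (hb : Even b) {t U : ℝ}
    (ht : t ≠ 0) (hU : 0 < U) {Λm : Matrix m m ℂ} (hΛ : Λm.PosSemidef)
    (O : m → Matrix (Finset (Orb (Fin a ×ₗ Fin b))) (Finset (Orb (Fin a ×ₗ Fin b))) ℂ)
    {κ : Type*} (s : Finset κ)
    (X : κ → Matrix (Finset (Orb (Fin a ×ₗ Fin b))) (Finset (Orb (Fin a ×ₗ Fin b))) ℂ)
    {ι : Type*} (t' : Finset ι)
    (Y Y' : ι → Matrix (Finset (Orb (Fin a ×ₗ Fin b))) (Finset (Orb (Fin a ×ₗ Fin b))) ℂ)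
    (e e' : ι → Fin 4)
    {κ₁ : Type*} [Fintype κ₁] {Gm : Matrix κ₁ κ₁ ℂ} (hGm : Gm.PosSemidef)
    (w : κ₁ → List ((Fin a ×ₗ Fin b) × (Fin a ×ₗ Fin b)))
    {κ₂ : Type*} [Fintype κ₂] {Gm' : Matrix κ₂ κ₂ ℂ} (hGm' : Gm'.PosSemidef)
    (w' : κ₂ → List ((Fin a ×ₗ Fin b) × (Fin a ×ₗ Fin b)))
    {κ₃ : Type*} (wr : Finset κ₃) (ar : κ₃ → ℂ)
    (word : κ₃ → List (Orb (Fin a ×ₗ Fin b) × Bool))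
    (hherm : (∑ k ∈ wr, ar k • ((word k).map fun p : Orb (Fin a ×ₗ Fin b) × Bool =>
      if p.2 then creation p.1 else annihilation p.1).prod).IsHermitian)
    {c : ℝ}
    (hcert : hamiltonian (fermionRectTorusGraph a b) t U - (c : ℂ) • 1 =
      gramForm Λm O + (∑ k ∈ s, (hamiltonian (fermionRectTorusGraph a b) t U * X k - X k * hamiltonian (fermionRectTorusGraph a b) t U) +
        ∑ q ∈ t', (Y q * singletSectorAnn (a * b) (e q) + singletSectorAnn (a * b) (e' q) * Y' q)) +
        (liebForm (rectSign a b) Gm w + liebFormFlip (rectSign a b) Gm' w' +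
          ∑ k ∈ wr, ar k • ((word k).map fun p : Orb (Fin a ×ₗ Fin b) × Bool =>
            if p.2 then creation p.1 else annihilation p.1).prod)) :
    c - ∑ k ∈ wr, ‖ar k‖ ≤ groundEnergyAt (fermionRectTorusGraph a b) t U (a * b) :=
  rect_groundEnergyAt_halfFilling_ge_of_certificate_liebGram a b ha hb ht hU hΛ O s X t' Y Y' e e' hGm w hGm' w'
    (R := ∑ k ∈ wr, ar k • ((word k).map fun p : Orb (Fin a ×ₗ Fin b) × Bool =>
      if p.2 then creation p.1 else annihilation p.1).prod)
    (δ := ∑ k ∈ wr, ‖ar k‖)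
    (Matrix.posSemidef_sum_smul_add_of_isContraction wr
      (fun k => ((word k).map fun p : Orb (Fin a ×ₗ Fin b) × Bool =>
        if p.2 then creation p.1 else annihilation p.1).prod)
      (fun k _ => isContraction_prod_ladder (word k)) ar hherm)
    hcert

/-- **Observable WINDOW row with Lieb Gram blocks (R2 rows at `n = 1`; the R2 ⇒ R3 edge shape).**
With an energy window `μ (E_up − H) + ν (H − E_lo)`, `μ, ν ≥ 0`, `E_lo ≤ E₀(ab) ≤ E_up`
(certified bounds), the null terms of `groundEnergyAt_halfFilling_ge_of_certificate_liebGram`,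
Lieb forms with `G, G' ⪰ 0` and a residual `R + δ·1 ⪰ 0`, an identity for `V − c·1` proves
`c − δ ≤ Re ⟨ψ, V ψ⟩` for every normalised `(ab, S^z = 0)` sector ground state `ψ` (at half
filling: THE ground state). [cite: LiebPRL1989, proof of Theorem 2] [cite: WangEtAl2024, §3 eq. (4)]
[cite: KullEtAl2024, §5.3] -/
theorem rect_re_expect_halfFilledGS_ge_of_windowCertificate_liebGram (ha : Even a) (hb : Even b) {t U : ℝ}
    (ht : t ≠ 0) (hU : 0 < U) {Λm : Matrix m m ℂ} (hΛ : Λm.PosSemidef)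
    (O : m → Matrix (Finset (Orb (Fin a ×ₗ Fin b))) (Finset (Orb (Fin a ×ₗ Fin b))) ℂ)
    {κ : Type*} (s : Finset κ)
    (X : κ → Matrix (Finset (Orb (Fin a ×ₗ Fin b))) (Finset (Orb (Fin a ×ₗ Fin b))) ℂ)
    {ι : Type*} (t' : Finset ι)
    (Y Y' : ι → Matrix (Finset (Orb (Fin a ×ₗ Fin b))) (Finset (Orb (Fin a ×ₗ Fin b))) ℂ)
    (e e' : ι → Fin 4)
    {κ₁ : Type*} [Fintype κ₁] {Gm : Matrix κ₁ κ₁ ℂ} (hGm : Gm.PosSemidef)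
    (w : κ₁ → List ((Fin a ×ₗ Fin b) × (Fin a ×ₗ Fin b)))
    {κ₂ : Type*} [Fintype κ₂] {Gm' : Matrix κ₂ κ₂ ℂ} (hGm' : Gm'.PosSemidef)
    (w' : κ₂ → List ((Fin a ×ₗ Fin b) × (Fin a ×ₗ Fin b)))
    {R : Matrix (Finset (Orb (Fin a ×ₗ Fin b))) (Finset (Orb (Fin a ×ₗ Fin b))) ℂ} {δ : ℝ}
    (hR : (R + (δ : ℂ) • (1 : Matrix (Finset (Orb (Fin a ×ₗ Fin b))) _ ℂ)).PosSemidef)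
    {V : Matrix (Finset (Orb (Fin a ×ₗ Fin b))) (Finset (Orb (Fin a ×ₗ Fin b))) ℂ}
    {Eup Elo μ ν c : ℝ} (hμ : 0 ≤ μ) (hν : 0 ≤ ν)
    (hup : groundEnergyAt (fermionRectTorusGraph a b) t U (a * b) ≤ Eup)
    (hlo : Elo ≤ groundEnergyAt (fermionRectTorusGraph a b) t U (a * b))
    (hcert : V - (c : ℂ) • 1 =
      gramForm Λm O + (∑ k ∈ s, (hamiltonian (fermionRectTorusGraph a b) t U * X k - X k * hamiltonian (fermionRectTorusGraph a b) t U) +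
        ∑ q ∈ t', (Y q * singletSectorAnn (a * b) (e q) + singletSectorAnn (a * b) (e' q) * Y' q)) +
        ((μ : ℂ) • ((Eup : ℂ) • 1 - hamiltonian (fermionRectTorusGraph a b) t U) +
          (ν : ℂ) • (hamiltonian (fermionRectTorusGraph a b) t U - (Elo : ℂ) • 1) +
          (liebForm (rectSign a b) Gm w + liebFormFlip (rectSign a b) Gm' w' + R))) :
    ∀ ψ : Fock (Orb (Fin a ×ₗ Fin b)), star ψ ⬝ᵥ ψ = 1 →
      IsGroundStateInSector (hamiltonian (fermionRectTorusGraph a b) t U) (a * b) 0 ψ →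
      c - δ ≤ (star ψ ⬝ᵥ V *ᵥ ψ).re := by
  classical
  intro ψ h1 hgs
  obtain ⟨hN, hHψ⟩ := rect_halfFilled_sectorGS_eigen a b ha t U hgs
  have hS := LiebHalfFilled.hubbardRectTorus_spinSq_mulVec_eq_zero_of_eigen ha hb ht hU hN hHψ
  have hpos : ∀ x, 0 ≤ srState ψ (star x * x) := fun x => vectorState_nonneg ψ x
  have hone : srState ψ 1 = 1 := by rw [srState_apply, one_mulVec, h1]
  have hn := rect_srState_null_eq_zero a b hN hS hHψ s X t' Y Y' e e'
  have hP : 0 ≤ (srState ψ (liebForm (rectSign a b) Gm w)).re := by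
    rw [srState_apply]
    exact (Complex.nonneg_iff.mp (hubbardRectTorus_liebForm_expect_nonneg ha hb ht hU hN hHψ hGm w)).1
  have hP' : 0 ≤ (srState ψ (liebFormFlip (rectSign a b) Gm' w')).re := by
    rw [srState_apply]
    exact (Complex.nonneg_iff.mp
      (hubbardRectTorus_liebFormFlip_expect_nonneg ha hb ht hU hN hHψ hGm' w')).1
  have hRre := re_srState_ge_of_posSemidef_add h1 hR
  set E₀ : ℝ := groundEnergyAt (fermionRectTorusGraph a b) t U (a * b) with hE₀
  have hH : srState ψ (hamiltonian (fermionRectTorusGraph a b) t U) = (E₀ : ℂ) := by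
    rw [srState_apply, hHψ, dotProduct_smul, h1, smul_eq_mul, mul_one]
  have hwin1 : (srState ψ ((μ : ℂ) • ((Eup : ℂ) • 1 - hamiltonian (fermionRectTorusGraph a b) t U))).re =
      μ * (Eup - E₀) := by
    rw [map_smul, map_sub, map_smul, hone, hH, smul_eq_mul, smul_eq_mul, mul_one,
      ← Complex.ofReal_sub, ← Complex.ofReal_mul, Complex.ofReal_re]
  have hwin2 : (srState ψ ((ν : ℂ) • (hamiltonian (fermionRectTorusGraph a b) t U - (Elo : ℂ) • 1))).re =
      ν * (E₀ - Elo) := by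
    rw [map_smul, map_sub, map_smul, hone, hH, smul_eq_mul, smul_eq_mul, mul_one,
      ← Complex.ofReal_sub, ← Complex.ofReal_mul, Complex.ofReal_re]
  have hw1 : 0 ≤ μ * (Eup - E₀) := mul_nonneg hμ (sub_nonneg.2 hup)
  have hw2 : 0 ≤ ν * (E₀ - Elo) := mul_nonneg hν (sub_nonneg.2 hlo)
  have hr : -δ ≤ (srState ψ ((μ : ℂ) • ((Eup : ℂ) • 1 - hamiltonian (fermionRectTorusGraph a b) t U) +
      (ν : ℂ) • (hamiltonian (fermionRectTorusGraph a b) t U - (Elo : ℂ) • 1) +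
      (liebForm (rectSign a b) Gm w + liebFormFlip (rectSign a b) Gm' w' + R))).re := by
    simp only [map_add, Complex.add_re]
    rw [hwin1, hwin2]
    linarith
  have h := le_re_map_of_certificate_residual (srState ψ) hpos hone hΛ O hn hr hcert
  rwa [srState_apply] at h

/-- Upper-bound form of `re_expect_halfFilledGS_ge_of_windowCertificate_liebGram`: a certificate
for `−V − c·1` proves `Re ⟨ψ, V ψ⟩ ≤ −c + δ`. [cite: LiebPRL1989, proof of Theorem 2]
[cite: WangEtAl2024, §3 eq. (4)] -/
theorem rect_re_expect_halfFilledGS_le_of_windowCertificate_liebGram (ha : Even a) (hb : Even b) {t U : ℝ}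
    (ht : t ≠ 0) (hU : 0 < U) {Λm : Matrix m m ℂ} (hΛ : Λm.PosSemidef)
    (O : m → Matrix (Finset (Orb (Fin a ×ₗ Fin b))) (Finset (Orb (Fin a ×ₗ Fin b))) ℂ)
    {κ : Type*} (s : Finset κ)
    (X : κ → Matrix (Finset (Orb (Fin a ×ₗ Fin b))) (Finset (Orb (Fin a ×ₗ Fin b))) ℂ)
    {ι : Type*} (t' : Finset ι)
    (Y Y' : ι → Matrix (Finset (Orb (Fin a ×ₗ Fin b))) (Finset (Orb (Fin a ×ₗ Fin b))) ℂ)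
    (e e' : ι → Fin 4)
    {κ₁ : Type*} [Fintype κ₁] {Gm : Matrix κ₁ κ₁ ℂ} (hGm : Gm.PosSemidef)
    (w : κ₁ → List ((Fin a ×ₗ Fin b) × (Fin a ×ₗ Fin b)))
    {κ₂ : Type*} [Fintype κ₂] {Gm' : Matrix κ₂ κ₂ ℂ} (hGm' : Gm'.PosSemidef)
    (w' : κ₂ → List ((Fin a ×ₗ Fin b) × (Fin a ×ₗ Fin b)))
    {R : Matrix (Finset (Orb (Fin a ×ₗ Fin b))) (Finset (Orb (Fin a ×ₗ Fin b))) ℂ} {δ : ℝ}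
    (hR : (R + (δ : ℂ) • (1 : Matrix (Finset (Orb (Fin a ×ₗ Fin b))) _ ℂ)).PosSemidef)
    {V : Matrix (Finset (Orb (Fin a ×ₗ Fin b))) (Finset (Orb (Fin a ×ₗ Fin b))) ℂ}
    {Eup Elo μ ν c : ℝ} (hμ : 0 ≤ μ) (hν : 0 ≤ ν)
    (hup : groundEnergyAt (fermionRectTorusGraph a b) t U (a * b) ≤ Eup)
    (hlo : Elo ≤ groundEnergyAt (fermionRectTorusGraph a b) t U (a * b))
    (hcert : -V - (c : ℂ) • 1 =
      gramForm Λm O + (∑ k ∈ s, (hamiltonian (fermionRectTorusGraph a b) t U * X k - X k * hamiltonian (fermionRectTorusGraph a b) t U) +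
        ∑ q ∈ t', (Y q * singletSectorAnn (a * b) (e q) + singletSectorAnn (a * b) (e' q) * Y' q)) +
        ((μ : ℂ) • ((Eup : ℂ) • 1 - hamiltonian (fermionRectTorusGraph a b) t U) +
          (ν : ℂ) • (hamiltonian (fermionRectTorusGraph a b) t U - (Elo : ℂ) • 1) +
          (liebForm (rectSign a b) Gm w + liebFormFlip (rectSign a b) Gm' w' + R))) :
    ∀ ψ : Fock (Orb (Fin a ×ₗ Fin b)), star ψ ⬝ᵥ ψ = 1 →
      IsGroundStateInSector (hamiltonian (fermionRectTorusGraph a b) t U) (a * b) 0 ψ →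
      (star ψ ⬝ᵥ V *ᵥ ψ).re ≤ -c + δ := by
  intro ψ h1 hgs
  have h := rect_re_expect_halfFilledGS_ge_of_windowCertificate_liebGram a b ha hb ht hU hΛ O s X t' Y Y' e e'
    hGm w hGm' w' hR hμ hν hup hlo hcert ψ h1 hgs
  rw [neg_mulVec, dotProduct_neg, Complex.neg_re] at h
  linarith

end RectTorus

end Summit.HubbardSuperconductivity.HubbardLadder
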